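import Mathlib
import HarnessLib
import Literature.NumberTheory.Transcendental.Associators
import Literature.NumberTheory.Transcendental.AssociatorsProofs

/-!
# `KernelModuloPeriodConjecture`, line `Sketch`: packaging of integer certificates for the leaf

Crux `FurushoPentagon.KernelModuloPeriodConjecture` (stmt-KontsevichZagierPeriods-15058), line
`Sketch`, algebraic leaf `AssociatorHoffmanSpanning` (per-weight slices). A per-weight certificate
for an admissible index `s` is an identity with CLEARED DENOMINATORS

  `D · c_{binaryWord s}(φ) = Σ_i n_i · c_{binaryWord t_i}(φ)`  (`D ∈ ℕ_{>0}`, `n_i ∈ ℤ`,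
  `t_i` Hoffman of the weight of `s`),

valid at every group-like solution `φ` of Drinfeld's pentagon over every commutative `ℚ`-algebra
(proved by `linear_combination` from shuffle and regularised-stuffle coefficient identities). This
file turns such an identity into the leaf's registered form
`∃ b : List ℕ →₀ ℚ, (support Hoffman of equal weight) ∧ ∀ R φ, … → c_{binaryWord s}(φ) = Σ_t b_t • c_{binaryWord t}(φ)`
(`leafCert_exists`), dividing by `D` in the `ℚ`-algebra; plus the evaluation of Furusho's `π_Y` on
Y-words of even/odd depth and the vanishing of the pure `x₁`-power coefficients, in the literal form
the per-weight files consume.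

References: K. Ihara, M. Kaneko, D. Zagier, Compos. Math. 142 (2006) §1–2 [IharaKanekoZagier2006];
H. Furusho, Ann. of Math. 174 (2011) Thm 1.2 [Furusho2011].
-/

namespace Summit.KontsevichZagierPeriods.FurushoPentagon.KernelModuloPeriodConjecture

open Literature.NumberTheory.Transcendental

/-- The support of the `Finsupp` `Σ_{(t,q) ∈ L} q δ_t` consists of keys of `L`. [folklore] -/
theorem leafCert_mem_of_mem_support (L : List (List ℕ × ℚ)) {t : List ℕ}
    (ht : t ∈ ((L.map fun p => Finsupp.single p.1 p.2).sum).support) : ∃ p ∈ L, p.1 = t := by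
  classical
  induction L with
  | nil => simp at ht
  | cons p L ih =>
    simp only [List.map_cons, List.sum_cons] at ht
    rcases Finset.mem_union.mp (Finsupp.support_add ht) with h | h
    · exact ⟨p, by simp, Finset.mem_singleton.mp (Finsupp.support_single_subset h) ▸ rfl⟩
    · obtain ⟨q, hq, rfl⟩ := ih h
      exact ⟨q, by simp [hq], rfl⟩

/-- Summing an additive family against `Σ_{(t,q) ∈ L} q δ_t` is the list sum over `L`. [folklore] -/
theorem leafCert_finsupp_sum {M : Type*} [AddCommMonoid M] (L : List (List ℕ × ℚ))
    (g : List ℕ → ℚ → M) (h0 : ∀ t, g t 0 = 0) (hadd : ∀ t a b, g t (a + b) = g t a + g t b) :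
    ((L.map fun p => Finsupp.single p.1 p.2).sum).sum g = (L.map fun p => g p.1 p.2).sum := by
  classical
  induction L with
  | nil => simp
  | cons p L ih =>
    simp only [List.map_cons, List.sum_cons]
    rw [Finsupp.sum_add_index' h0 hadd, Finsupp.sum_single_index (h0 _), ih]

/-- Division by a positive integer in a `ℚ`-algebra: from `D · x = Σ n_i · y_i` to
`x = Σ (n_i / D) • y_i`. [folklore] -/
theorem leafCert_eq_sum_smul {R : Type} [CommRing R] [Algebra ℚ R] {D : ℕ} (hD : D ≠ 0) {x : R}
    (L : List (ℤ × R)) (h : (D : R) * x = (L.map fun p => (p.1 : R) * p.2).sum) :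
    x = (L.map fun p => ((p.1 : ℚ) / D) • p.2).sum := by
  have hD' : (D : ℚ) ≠ 0 := by exact_mod_cast hD
  have hx : x = ((D : ℚ)⁻¹) • ((D : R) * x) := by
    rw [show ((D : R) * x) = (D : ℚ) • x by
      rw [Algebra.smul_def, map_natCast], smul_smul, inv_mul_cancel₀ hD', one_smul]
  rw [hx, h, List.smul_sum, List.map_map]
  congr 1
  refine List.map_congr_left fun p _ => ?_
  simp only [Function.comp_apply]
  rw [show ((p.1 : R) * p.2) = (p.1 : ℚ) • p.2 by
    rw [Algebra.smul_def, map_intCast], smul_smul, div_eq_inv_mul]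

/-- **Integer certificate ⇒ the leaf for `s`.** If `D · c_{binaryWord s}(φ) = Σ n_i c_{binaryWord t_i}(φ)`
holds at every group-like pentagon solution over every commutative `ℚ`-algebra, with all `t_i`
Hoffman of the weight of `s` and `D ≠ 0`, then the algebraic leaf holds for `s` (witness
`b = Σ_i (n_i / D) δ_{t_i}`; reducedness of the coefficient ring is not used).
[cite: IharaKanekoZagier2006, §2] -/
theorem leafCert_exists (s : List ℕ) (D : ℕ) (hD : D ≠ 0) (L : List (List ℕ × ℤ))
    (hL : ∀ p ∈ L, MZV.IsHoffman p.1 ∧ MZV.weight p.1 = MZV.weight s)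
    (h : ∀ (R : Type) [CommRing R] [Algebra ℚ R] (φ : NCSeries Bool R),
      NCSeries.IsGroupLike φ → NCSeries.DrinfeldPentagon φ →
        (D : R) * φ (MZV.binaryWord s) = (L.map fun p => (p.2 : R) * φ (MZV.binaryWord p.1)).sum) :
    ∃ b : List ℕ →₀ ℚ, (∀ t ∈ b.support, MZV.IsHoffman t ∧ MZV.weight t = MZV.weight s) ∧ ∀ (R : Type) [CommRing R] [Algebra ℚ R] [IsReduced R] (φ : NCSeries Bool R), NCSeries.IsGroupLike φ → NCSeries.DrinfeldPentagon φ → φ (MZV.binaryWord s) = b.sum (fun t q => q • φ (MZV.binaryWord t)) := by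
  refine ⟨((L.map fun p => (p.1, (p.2 : ℚ) / D)).map fun p => Finsupp.single p.1 p.2).sum,
    fun t ht => ?_, fun R _ _ _ φ hg h5 => ?_⟩
  · obtain ⟨p, hp, rfl⟩ := leafCert_mem_of_mem_support _ ht
    obtain ⟨q, hq, rfl⟩ := List.mem_map.mp hp
    exact hL q hq
  · rw [leafCert_finsupp_sum _ (fun t q => q • φ (MZV.binaryWord t)) (fun t => zero_smul ℚ _)
      (fun t a b => add_smul a b _), List.map_map]
    have := leafCert_eq_sum_smul hD (L.map fun p => (p.2, φ (MZV.binaryWord p.1)))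
      (by rw [List.map_map]; exact h R φ hg h5)
    rw [this, List.map_map]
    rfl

/-- Evaluation of Furusho's `π_Y` on a Y-word of even depth: `π_Y(φ)(s) = c_{binaryWord s}(φ)`.
[cite: Furusho2011, §2] -/
theorem leafCert_piY_even {R : Type} [CommRing R] (φ : NCSeries Bool R) {s : List ℕ} {w : List Bool}
    (hs : ∀ i ∈ s, 1 ≤ i) (hw : MZV.binaryWord s = w) (hl : Even s.length) :
    NCSeries.piY φ s = φ w := by
  rw [NCSeries.piY_apply_of_forall_pos φ hs, hw, hl.neg_one_pow, one_mul]

/-- Evaluation of Furusho's `π_Y` on a Y-word of odd depth: `π_Y(φ)(s) = -c_{binaryWord s}(φ)`.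
[cite: Furusho2011, §2] -/
theorem leafCert_piY_odd {R : Type} [CommRing R] (φ : NCSeries Bool R) {s : List ℕ} {w : List Bool}
    (hs : ∀ i ∈ s, 1 ≤ i) (hw : MZV.binaryWord s = w) (hl : Odd s.length) :
    NCSeries.piY φ s = -φ w := by
  rw [NCSeries.piY_apply_of_forall_pos φ hs, hw, hl.neg_one_pow, neg_one_mul]

/-- The pure `x₁`-powers have vanishing coefficients at a group-like pentagon solution:
`c_{x₁ⁿ}(φ) = 0` for the literal word `List.replicate n true`. [cite: Furusho2011, §2] -/
theorem leafCert_replicate_true {R : Type} [CommRing R] [Algebra ℚ R] {φ : NCSeries Bool R}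
    (hg : NCSeries.IsGroupLike φ) (h5 : NCSeries.DrinfeldPentagon φ) (n : ℕ) (hn : n ≠ 0) :
    φ (List.replicate n true) = 0 :=
  hg.apply_replicate_eq_zero (h5.apply_letter_eq_zero_of_isGroupLike hg true) n hn

/-- **Registered sub-goal `stub_leafCert`** (crux stmt-KontsevichZagierPeriods-15058, line `Sketch`): an
integer certificate `D · c_{binaryWord s} = Σ n_i c_{binaryWord t_i}` at every group-like pentagon solution
packages into the algebraic leaf for `s` (`leafCert_exists`, `∀`-form). [cite: IharaKanekoZagier2006, §2] -/
theorem stub_leafCert : ∀ (s : List ℕ) (D : ℕ), D ≠ 0 → ∀ (L : List (List ℕ × ℤ)), (∀ p ∈ L, MZV.IsHoffman p.1 ∧ MZV.weight p.1 = MZV.weight s) → (∀ (R : Type) [CommRing R] [Algebra ℚ R] (φ : NCSeries Bool R), NCSeries.IsGroupLike φ → NCSeries.DrinfeldPentagon φ → (D : R) * φ (MZV.binaryWord s) = (L.map fun p => (p.2 : R) * φ (MZV.binaryWord p.1)).sum) → ∃ b : List ℕ →₀ ℚ, (∀ t ∈ b.support, MZV.IsHoffman t ∧ MZV.weight t = MZV.weight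 s) ∧ ∀ (R : Type) [CommRing R] [Algebra ℚ R] [IsReduced R] (φ : NCSeries Bool R), NCSeries.IsGroupLike φ → NCSeries.DrinfeldPentagon φ → φ (MZV.binaryWord s) = b.sum (fun t q => q • φ (MZV.binaryWord t)) :=
  fun s D hD L hL h => leafCert_exists s D hD L hL h

end Summit.KontsevichZagierPeriods.FurushoPentagon.KernelModuloPeriodConjecture
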